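import Summits.QuantumFields.GaugeBoot.WordDerivative
import Literature.MathematicalPhysics.QuantumLattice.GrassmannIntegralWilsonProofs
import HarnessLib

/-!
# The derivative of the Wilson action along the one-link shift = plaquette insertions (cell `gauge-boot`, L1, file 3/5)

Honest framing (cell rule): certified bounds on lattice expectations at stated coupling, gauge group, dimension and
torus size; NOT a mass gap, NOT a continuum limit, NOT a string tension; not summit-bearing
(`FixedCouplingUltralocality`, `PerturbativeInvisibility`).

For the tree's Wilson action `wilsonAction ρ U = Σ_{p : Plaquette} (N − Re tr ρ(U_p))` (`ConstructiveQFTWave0.lean`),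
the flow derivative along `U ↦ U[e ↦ k(t)U_e]`, `ρ(k t) = exp(tX)`, is `actionDeriv ρ e X U :=
−Σ_p Re tr(insDeriv_p)` (`hasDerivAt_wilsonAction`, `continuous_actionDeriv`).  The combinatorial heart of the lattice
loop equation is then the RE-INDEXING of this plaquette sum (valid on every torus `L ≥ 1`): exactly the `2(d−1)`
plaquettes through `e = (x, μ)` contribute, each once, RE-ORIENTED TO START WITH `e` (`plaqWord μ ν ε`,
`sum_trace_insDeriv_plaquette`), and for skew-Hermitian `X` and unitary `ρ` the derivative takes the symmetric,
`ℂ`-linear-in-`X` form `actionDeriv = −½·plaqIns`, `plaqIns = Σ_{ν≠μ} Σ_{ε=±} tr(X·(ρ(hol P̃_{ν,ε}) − ρ(hol P̃_{ν,ε}⁻¹)))`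
(`actionDeriv_eq_plaqIns`) — the `D_a Re Tr U_P` line of the cell's MM-DERIVATION.md §3.
Everything is `[folklore]` (finite sums, trace cyclicity); no measure theory here.

References: Kazakov–Zheng, arXiv:2404.16925 §2 (plaquette terms `A_var` of the loop equation); Guo–Li–Yang–Zhu,
arXiv:2502.14421 §2; cell file `pub-gaugeboot-loop/MM-DERIVATION.md` §§1–4.
-/

noncomputable section

open MeasureTheory Filter Topology NormedSpace
open scoped Matrix.Norms.Frobenius Matrix
open Literature.MathematicalPhysics.QuantumFieldTheory
open Summit.QuantumFields.YangMills.Cruxes.CurvatureAmnesia.WardDefect.SchwingerDyson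

namespace Summit.QuantumFields.GaugeBoot

variable {d L N : ℕ} {G : Type} [Group G] {ρ : G →* Matrix (Fin N) (Fin N) ℂ} (e : Edge d L)
  {X : Matrix (Fin N) (Fin N) ℂ} {k : ℝ → G}

/-! ### The derivative of the Wilson action along the shift: plaquette insertions at `e` -/

section ActionDeriv

variable (ρ X)

/-- The plaquette words through the edge `(x, μ)` RE-ORIENTED TO START WITH IT: `P̃_{ν,+} = +μ +ν −μ −ν` and
`P̃_{ν,−} = +μ −ν −μ +ν` (`ν ≠ μ`), read from `x`. [folklore] -/
def plaqWord (μ ν : Fin d) : Bool → Word d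
  | true => [.fwd μ, .fwd ν, .bwd μ, .bwd ν]
  | false => [.fwd μ, .bwd ν, .bwd μ, .fwd ν]

/-- Unfolding lemma `plaqWord_true`. [folklore] -/
@[simp] theorem plaqWord_true (μ ν : Fin d) : plaqWord μ ν true = Word.plaquette μ ν := rfl

/-- Unfolding lemma `plaqWord_false`. [folklore] -/
@[simp] theorem plaqWord_false (μ ν : Fin d) : plaqWord μ ν false = [.fwd μ, .bwd ν, .bwd μ, .fwd ν] := rfl

/-- The re-oriented plaquette words are closed. [folklore] -/
@[simp] theorem endpoint_plaqWord (x : Site d L) (μ ν : Fin d) (ε : Bool) :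
    Word.endpoint x (plaqWord μ ν ε) = x := by
  cases ε <;> simp [plaqWord, Site.shift] <;> abel

/-- The flow derivative of the Wilson action `S = Σ_p (N − Re tr ρ(U_p))` along the one-link shift at `e` in
direction `X`: minus the real part of the insertion derivatives of all plaquette words. [folklore] -/
def actionDeriv [NeZero L] (U : GaugeConfig d L G) : ℝ :=
  -∑ p : Plaquette d L, ((insDeriv ρ e X U p.1 (Word.plaquette p.2.1.1 p.2.1.2)).trace).re

variable {ρ X}

/-- **The Wilson action is differentiable along the one-link shift with derivative `actionDeriv`.** [folklore] -/
theorem hasDerivAt_wilsonAction [NeZero L] (hk : ∀ s t, k (s + t) = k s * k t)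
    (hX : ∀ t, ρ (k t) = exp ((t : ℂ) • X)) (U : GaugeConfig d L G) :
    HasDerivAt (fun t : ℝ => wilsonAction (d := d) (L := L) ρ (Function.update U e (k t * U e)))
      (actionDeriv ρ e X U) 0 := by
  unfold wilsonAction actionDeriv
  rw [← Finset.sum_neg_distrib]
  refine HasDerivAt.fun_sum fun p _ => ?_
  have h := (hasDerivAt_reTrace (hasDerivAt_wordHolonomy (e := e) hk hX U p.1
    (Word.plaquette p.2.1.1 p.2.1.2))).const_sub (N : ℝ)
  simpa only [wordHolonomy_plaquette] using h

/-- `actionDeriv` is continuous in the configuration (for continuous `ρ`). [folklore] -/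
theorem continuous_actionDeriv [NeZero L] [TopologicalSpace G] [IsTopologicalGroup G] (hρ : Continuous ρ) :
    Continuous fun U : GaugeConfig d L G => actionDeriv ρ e X U := by
  unfold actionDeriv
  refine (continuous_finsetSum _ fun p _ => ?_).neg
  exact Complex.continuous_re.comp ((continuous_insDeriv (e := e) (X := X) hρ p.1 _).matrix_trace)

/-- Site bookkeeping: `(y + e_i + e_j) − e_i = y + e_j`. [folklore] -/
theorem shift_shift_sub (y : Site d L) (i j : Fin d) : (y.shift i).shift j - Pi.single i 1 = y.shift j := by
  simp only [Site.shift]; abel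

/-- Site bookkeeping: `(y + e_j) − e_j = y`. [folklore] -/
theorem shift_sub (y : Site d L) (j : Fin d) : y.shift j - Pi.single j 1 = y := by
  simp [Site.shift]

/-- Trace cyclicity helper (slot 1 of a plaquette word). [folklore] -/
theorem trace_cyc₀ (X E B C D : Matrix (Fin N) (Fin N) ℂ) :
    (X * E * (B * (C * D))).trace = (X * (E * (B * (C * D)))).trace := by
  simp only [Matrix.mul_assoc]

/-- Trace cyclicity helper (slot 2). [folklore] -/
theorem trace_cyc₁ (A X E B C : Matrix (Fin N) (Fin N) ℂ) :
    (A * (X * E * (B * C))).trace = (X * (E * (B * (C * A)))).trace := by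
  rw [Matrix.trace_mul_comm A]
  simp only [Matrix.mul_assoc]

/-- Trace cyclicity helper (slot 3). [folklore] -/
theorem trace_cyc₂ (A B E X C : Matrix (Fin N) (Fin N) ℂ) :
    (A * (B * (E * -X * C))).trace = -(X * (C * (A * (B * E)))).trace := by
  simp only [Matrix.mul_neg, Matrix.neg_mul, Matrix.trace_neg, neg_inj, ← Matrix.mul_assoc]
  rw [Matrix.trace_mul_cycle, Matrix.trace_mul_cycle]
  simp only [Matrix.mul_assoc]

/-- Trace cyclicity helper (slot 4). [folklore] -/
theorem trace_cyc₃ (A B E C X : Matrix (Fin N) (Fin N) ℂ) :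
    (A * (B * (E * (C * -X)))).trace = -(X * (A * (B * (E * C)))).trace := by
  simp only [Matrix.mul_neg, Matrix.trace_neg, neg_inj, ← Matrix.mul_assoc]
  rw [Matrix.trace_mul_cycle]
  simp only [Matrix.mul_assoc]

/-- **Insertion derivative of one plaquette word, term by term** (the four slots of `+i +j −i −j` at `y`), each
term brought to the form `±tr(X·ρ(hol))` of a closed 4-letter word by cyclicity of the trace. [folklore] -/
theorem trace_insDeriv_plaquette (U : GaugeConfig d L G) (y : Site d L) (i j : Fin d) :
    (insDeriv ρ e X U y (Word.plaquette i j)).trace =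
      (if (y, i) = e then (X * ρ (wordHolonomy U y (Word.plaquette i j))).trace else 0) +
      (if (y.shift i, j) = e then (X * ρ (wordHolonomy U (y.shift i) [.fwd j, .bwd i, .bwd j, .fwd i])).trace
        else 0) -
      (if (y.shift j, i) = e then (X * ρ (wordHolonomy U (y.shift j) [.bwd j, .fwd i, .fwd j, .bwd i])).trace
        else 0) -
      (if (y, j) = e then (X * ρ (wordHolonomy U y (Word.plaquette i j))).trace else 0) := by
  simp only [Word.plaquette, insDeriv_cons, insDeriv_nil, stepIns, Step.edge_fwd, Step.edge_bwd, Step.isFwd_fwd,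
    Step.isFwd_bwd, if_true, Bool.false_eq_true, if_false, Step.apply_fwd, Step.apply_bwd, shift_shift_sub,
    shift_sub, wordHolonomy_cons, wordHolonomy_nil, stepHolonomy_fwd, stepHolonomy_bwd, mul_one, Matrix.mul_zero,
    add_zero, map_mul, Matrix.mul_add, Matrix.trace_add, map_one]
  rw [show ∀ a b c d' : ℂ, a + b - c - d' = a + (b + (-c + -d')) from fun _ _ _ _ => by ring]
  refine congrArg₂ (· + ·) ?_ (congrArg₂ (· + ·) ?_ (congrArg₂ (· + ·) ?_ ?_))
  · split_ifs with h
    · subst h; exact trace_cyc₀ _ _ _ _ _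
    · simp
  · split_ifs with h
    · subst h; exact trace_cyc₁ _ _ _ _ _
    · simp
  · split_ifs with h
    · subst h; exact trace_cyc₂ _ _ _ _ _
    · simp
  · split_ifs with h
    · subst h; exact trace_cyc₃ _ _ _ _ _
    · simp


/-! ### Re-indexing the plaquette sum -/

section Collapse

variable {M : Type*} [AddCommMonoid M]

/-- Finite-sum bookkeeping lemma `sum_plaquette_eq` (re-indexing plaquette sums). [folklore] -/
theorem sum_plaquette_eq [NeZero L] (f : Site d L → Fin d → Fin d → M) :
    ∑ p : Plaquette d L, f p.1 p.2.1.1 p.2.1.2 =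
      ∑ i : Fin d, ∑ j : Fin d, if i < j then ∑ y : Site d L, f y i j else 0 := by
  rw [Fintype.sum_prod_type, Finset.sum_comm]
  have h : ∑ q : {p : Fin d × Fin d // p.1 < p.2}, ∑ y : Site d L, f y q.1.1 q.1.2 =
      ∑ p ∈ (Finset.univ : Finset (Fin d × Fin d)).filter (fun p => p.1 < p.2), ∑ y : Site d L, f y p.1 p.2 := by
    rw [← Finset.sum_subtype_eq_sum_filter, Finset.subtype_univ]
  rw [h, Finset.sum_filter, Fintype.sum_prod_type]

/-- Finite-sum bookkeeping lemma `sum_site_ite_and_eq` (re-indexing plaquette sums). [folklore] -/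
theorem sum_site_ite_and_eq [NeZero L] (x : Site d L) (c : Prop) [Decidable c] (Φ : Site d L → M) :
    ∑ y : Site d L, (if y = x ∧ c then Φ y else 0) = if c then Φ x else 0 := by
  by_cases hc : c
  · simp [hc, Finset.sum_ite_eq']
  · simp [hc]

/-- Finite-sum bookkeeping lemma `sum_site_ite_shift_and_eq` (re-indexing plaquette sums). [folklore] -/
theorem sum_site_ite_shift_and_eq [NeZero L] (x : Site d L) (i : Fin d) (c : Prop) [Decidable c]
    (F : Site d L → Fin d → Fin d → M) (a b : Fin d) :
    ∑ y : Site d L, (if y.shift i = x ∧ c then F (y.shift i) a b else 0) = if c then F x a b else 0 := by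
  have h := (Equiv.subRight (Pi.single i (1 : ZMod L))).sum_comp
    (fun y : Site d L => if y.shift i = x ∧ c then F (y.shift i) a b else 0)
  rw [← h]
  simp only [Equiv.subRight_apply, Site.shift, sub_add_cancel]
  exact sum_site_ite_and_eq x c (fun z => F z a b)

/-- Finite-sum bookkeeping lemma `sum_sum_ite_lt_eq_left` (re-indexing plaquette sums). [folklore] -/
theorem sum_sum_ite_lt_eq_left (μ : Fin d) (H : Fin d → Fin d → M) :
    ∑ i : Fin d, ∑ j : Fin d, (if i < j then (if i = μ then H i j else 0) else 0) =
      ∑ j : Fin d, if μ < j then H μ j else 0 := by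
  rw [Finset.sum_comm]
  refine Finset.sum_congr rfl fun j _ => ?_
  rw [Finset.sum_congr rfl fun i _ => show (if i < j then (if i = μ then H i j else 0) else 0) =
    if i = μ then (if i < j then H i j else 0) else 0 by split_ifs <;> rfl]
  simp [Finset.sum_ite_eq']

/-- Finite-sum bookkeeping lemma `sum_sum_ite_lt_eq_right` (re-indexing plaquette sums). [folklore] -/
theorem sum_sum_ite_lt_eq_right (μ : Fin d) (H : Fin d → Fin d → M) :
    ∑ i : Fin d, ∑ j : Fin d, (if i < j then (if j = μ then H i j else 0) else 0) =
      ∑ i : Fin d, if i < μ then H i μ else 0 := by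
  refine Finset.sum_congr rfl fun i _ => ?_
  rw [Finset.sum_congr rfl fun j _ => show (if i < j then (if j = μ then H i j else 0) else 0) =
    if j = μ then (if i < j then H i j else 0) else 0 by split_ifs <;> rfl]
  simp [Finset.sum_ite_eq']

/-- [folklore] Collapse, slot 1: condition `(y, i) = (x, μ)`. -/
theorem collapse₀ [NeZero L] (x : Site d L) (μ : Fin d) (F : Site d L → Fin d → Fin d → M) :
    ∑ p : Plaquette d L, (if (p.1, p.2.1.1) = (x, μ) then F p.1 p.2.1.1 p.2.1.2 else 0) =
      ∑ ν : Fin d, if μ < ν then F x μ ν else 0 := by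
  rw [sum_plaquette_eq (fun y i j => if (y, i) = (x, μ) then F y i j else 0)]
  simp only [Prod.mk.injEq, sum_site_ite_and_eq]
  exact sum_sum_ite_lt_eq_left μ (F x)

/-- [folklore] Collapse, slot 2: condition `(y + e_i, j) = (x, μ)`, summand through `y + e_i`. -/
theorem collapse₁ [NeZero L] (x : Site d L) (μ : Fin d) (F : Site d L → Fin d → Fin d → M) :
    ∑ p : Plaquette d L, (if (p.1.shift p.2.1.1, p.2.1.2) = (x, μ) then F (p.1.shift p.2.1.1) p.2.1.1 p.2.1.2
      else 0) = ∑ ν : Fin d, if ν < μ then F x ν μ else 0 := by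
  rw [sum_plaquette_eq (fun y i j => if (y.shift i, j) = (x, μ) then F (y.shift i) i j else 0)]
  simp only [Prod.mk.injEq, sum_site_ite_shift_and_eq]
  exact sum_sum_ite_lt_eq_right μ (F x)

/-- [folklore] Collapse, slot 3: condition `(y + e_j, i) = (x, μ)`, summand through `y + e_j`. -/
theorem collapse₂ [NeZero L] (x : Site d L) (μ : Fin d) (F : Site d L → Fin d → Fin d → M) :
    ∑ p : Plaquette d L, (if (p.1.shift p.2.1.2, p.2.1.1) = (x, μ) then F (p.1.shift p.2.1.2) p.2.1.1 p.2.1.2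
      else 0) = ∑ ν : Fin d, if μ < ν then F x μ ν else 0 := by
  rw [sum_plaquette_eq (fun y i j => if (y.shift j, i) = (x, μ) then F (y.shift j) i j else 0)]
  simp only [Prod.mk.injEq, sum_site_ite_shift_and_eq]
  exact sum_sum_ite_lt_eq_left μ (F x)

/-- [folklore] Collapse, slot 4: condition `(y, j) = (x, μ)`. -/
theorem collapse₃ [NeZero L] (x : Site d L) (μ : Fin d) (F : Site d L → Fin d → Fin d → M) :
    ∑ p : Plaquette d L, (if (p.1, p.2.1.2) = (x, μ) then F p.1 p.2.1.1 p.2.1.2 else 0) =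
      ∑ ν : Fin d, if ν < μ then F x ν μ else 0 := by
  rw [sum_plaquette_eq (fun y i j => if (y, j) = (x, μ) then F y i j else 0)]
  simp only [Prod.mk.injEq, sum_site_ite_and_eq]
  exact sum_sum_ite_lt_eq_right μ (F x)

end Collapse

/-! ### Assembling: the plaquette sum in raw and in symmetric form -/

/-- Unfolding lemma `reverse_plaqWord_true`: the reverse of `+μ +ν −μ −ν` is the plaquette word `+ν +μ −ν −μ`. [folklore] -/
@[simp] theorem reverse_plaqWord_true (μ ν : Fin d) : (plaqWord μ ν true).reverse = Word.plaquette ν μ := rfl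

/-- Unfolding lemma `reverse_plaqWord_false`. [folklore] -/
@[simp] theorem reverse_plaqWord_false (μ ν : Fin d) :
    (plaqWord μ ν false).reverse = [.bwd ν, .fwd μ, .fwd ν, .bwd μ] := rfl

/-- **Raw plaquette-insertion sum.** Summing the insertion derivatives of all plaquette words of the torus for the
edge `e = (x, μ)`: each of the `2(d−1)` plaquettes through `e` contributes once, re-oriented to start with `e`;
planes `(μ, ν)` with `μ < ν` through the slots 1 and 3 of the tree's orientation, planes with `ν < μ` through the
slots 2 and 4 (valid on every torus, `L ≥ 1`). [folklore] -/
theorem sum_trace_insDeriv_plaquette [NeZero L] (U : GaugeConfig d L G) (x : Site d L) (μ : Fin d) :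
    ∑ p : Plaquette d L, (insDeriv ρ (x, μ) X U p.1 (Word.plaquette p.2.1.1 p.2.1.2)).trace =
      ∑ ν : Fin d, (if μ < ν then ((X * ρ (wordHolonomy U x (plaqWord μ ν true))).trace -
          (X * ρ (wordHolonomy U x (plaqWord μ ν false).reverse)).trace) else 0) +
      ∑ ν : Fin d, (if ν < μ then ((X * ρ (wordHolonomy U x (plaqWord μ ν false))).trace -
          (X * ρ (wordHolonomy U x (plaqWord μ ν true).reverse)).trace) else 0) := by
  simp only [trace_insDeriv_plaquette, Finset.sum_sub_distrib, Finset.sum_add_distrib]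
  rw [collapse₀ x μ (fun y i j => (X * ρ (wordHolonomy U y (Word.plaquette i j))).trace),
    collapse₁ x μ (fun z i j => (X * ρ (wordHolonomy U z [.fwd j, .bwd i, .bwd j, .fwd i])).trace),
    collapse₂ x μ (fun z i j => (X * ρ (wordHolonomy U z [.bwd j, .fwd i, .fwd j, .bwd i])).trace),
    collapse₃ x μ (fun y i j => (X * ρ (wordHolonomy U y (Word.plaquette i j))).trace)]
  have hsplit : ∀ (c : Prop) [Decidable c] (a b : ℂ),
      (if c then a - b else 0) = (if c then a else 0) - (if c then b else 0) := by
    intros; split_ifs <;> simp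
  simp only [hsplit, Finset.sum_sub_distrib, reverse_plaqWord_true, reverse_plaqWord_false]
  simp only [plaqWord_true, plaqWord_false]
  ring

/-- For a closed word, the reversed word carries the ADJOINT matrix (unitary `ρ`). [folklore] -/
theorem rho_wordHolonomy_reverse (hρ : ∀ g, ρ g ∈ Matrix.unitaryGroup (Fin N) ℂ) (U : GaugeConfig d L G)
    (x : Site d L) (w : Word d) (hw : Word.endpoint x w = x) :
    ρ (wordHolonomy U x w.reverse) = (ρ (wordHolonomy U x w))ᴴ := by
  have h := wordHolonomy_reverse U x w
  rw [hw] at h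
  rw [h, Literature.MathematicalPhysics.QuantumLattice.unitaryRep_inv_eq_conjTranspose ρ hρ]

/-- `Re tr(X M) = ½ tr(X (M − Mᴴ))` for skew-Hermitian `X` (as a complex number). [folklore] -/
theorem re_trace_skew_mul (hX : Xᴴ = -X) (M : Matrix (Fin N) (Fin N) ℂ) :
    (((X * M).trace.re : ℝ) : ℂ) = (1 / 2) * (X * (M - Mᴴ)).trace := by
  have h : (starRingEnd ℂ) (X * M).trace = -(X * Mᴴ).trace := by
    rw [← Complex.star_def, ← Matrix.trace_conjTranspose, Matrix.conjTranspose_mul, hX, Matrix.mul_neg,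
      Matrix.trace_neg, Matrix.trace_mul_comm]
  rw [Complex.re_eq_add_conj, h, Matrix.mul_sub, Matrix.trace_sub]
  ring

/-- `Re tr(X Mᴴ) = −½ tr(X (M − Mᴴ))` for skew-Hermitian `X`. [folklore] -/
theorem re_trace_skew_mul_conjTranspose (hX : Xᴴ = -X) (M : Matrix (Fin N) (Fin N) ℂ) :
    (((X * Mᴴ).trace.re : ℝ) : ℂ) = -(1 / 2) * (X * (M - Mᴴ)).trace := by
  rw [re_trace_skew_mul hX, Matrix.conjTranspose_conjTranspose, Matrix.mul_sub, Matrix.mul_sub, Matrix.trace_sub,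
    Matrix.trace_sub]
  ring

variable (ρ X) in
/-- The PLAQUETTE INSERTION functional at the edge `(x, μ)`: `Σ_{ν ≠ μ} Σ_{ε = ±} tr(X·(ρ(hol P̃_{ν,ε}) − ρ(hol P̃_{ν,ε}⁻¹)))`
— manifestly `ℂ`-linear in `X`; for skew-Hermitian `X` and unitary `ρ` it equals `2 Σ Re tr(X ρ(hol P̃))`. [folklore] -/
def plaqIns (U : GaugeConfig d L G) (x : Site d L) (μ : Fin d) : ℂ :=
  ∑ ν ∈ Finset.univ.erase μ, ∑ ε : Bool,
    (X * (ρ (wordHolonomy U x (plaqWord μ ν ε)) - ρ (wordHolonomy U x (plaqWord μ ν ε).reverse))).trace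

/-- **The derivative of the Wilson action along the shift, symmetric form**: for skew-Hermitian `X` and unitary `ρ`,
`S'(U) = −½ · plaqIns`, i.e. `−Σ_{ν≠μ, ε} Re tr(X ρ(hol P̃_{ν,ε}))` — minus the sum of `X`-insertions into the `2(d−1)`
plaquettes through `e`, each re-oriented to start with `e` (MM-DERIVATION §3, the `D_a Re Tr U_P` line). [folklore] -/
theorem actionDeriv_eq_plaqIns [NeZero L] (hX : Xᴴ = -X) (hρ : ∀ g, ρ g ∈ Matrix.unitaryGroup (Fin N) ℂ)
    (U : GaugeConfig d L G) (x : Site d L) (μ : Fin d) :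
    ((actionDeriv ρ (x, μ) X U : ℝ) : ℂ) = -(1 / 2) * plaqIns ρ X U x μ := by
  have hP : ∀ ν ε, ρ (wordHolonomy U x (plaqWord μ ν ε).reverse) = (ρ (wordHolonomy U x (plaqWord μ ν ε)))ᴴ :=
    fun ν ε => rho_wordHolonomy_reverse hρ U x _ (endpoint_plaqWord x μ ν ε)
  unfold actionDeriv plaqIns
  rw [← Complex.re_sum, sum_trace_insDeriv_plaquette, Complex.ofReal_neg, Complex.add_re, Complex.ofReal_add,
    Complex.re_sum, Complex.re_sum, Complex.ofReal_sum, Complex.ofReal_sum]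
  simp only [apply_ite Complex.re, Complex.zero_re, apply_ite ((↑) : ℝ → ℂ), Complex.ofReal_zero, Complex.sub_re,
    Complex.ofReal_sub, hP, re_trace_skew_mul hX, Matrix.conjTranspose_conjTranspose, Matrix.mul_sub,
    Matrix.trace_sub, Fintype.sum_bool]
  rw [← Finset.sum_add_distrib, Finset.mul_sum, ← Finset.sum_neg_distrib]
  rw [← Finset.sum_subset (Finset.subset_univ (Finset.univ.erase μ)) (fun ν _ hν => by
    have hν' : ν = μ := by simpa using hν
    subst hν'
    simp)]
  refine Finset.sum_congr rfl fun ν hν => ?_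
  have hne : ν ≠ μ := Finset.ne_of_mem_erase hν
  rcases lt_or_gt_of_ne hne with h | h
  · simp only [h, if_true, not_lt.2 h.le, if_false]
    ring
  · simp only [h, if_true, not_lt.2 h.le, if_false]
    ring


end ActionDeriv

end Summit.QuantumFields.GaugeBoot

end
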